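import Summits.QuantumFields.YangMills.Theorems.ToronValleyVolumeLojasiewiczLocaliseRing
import Summits.QuantumFields.YangMills.Theorems.LuscherReductionTwistedTraceScalingLatticeHS
import Summits.QuantumFields.YangMills.Theorems.LuscherReductionTwistedTraceScalingElectricSplit
import Literature.MathematicalPhysics.QuantumLattice.SU2HaarSmallBall
import HarnessLib

/-!
# Route `VirialFluxGap` (YangMills): the PERIODIC VOLUME FLOOR — a polynomial lower bound for the small-ball volume of the
# zero-flux ring deficit

Toward the deciding crux `VirialFluxGap.PeriodicSoftness` (item stmt-QuantumFields-24141, the route's last open leaf).  Every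
reduction of `PeriodicSoftness` on the table — the sub-route `ToronValleyVolume` (two-sided tube volume law), the ONE-SIDED
Tauberian reduction ✓`ScalingTauber.scalingTauber` (its floor input `m₁ ≤ m(t₀)`), and the virial ∕ integration-by-parts route
(discarding the region `{F₀ > t₀}` under the Gibbs weight) — needs a FLOOR for the volume function
`m₀(t) = ringMeasure L {F₀ ≤ t}` of the zero-flux action deficit `F₀ = RingDeficit.ringDeficit L 0` at ONE polynomial scale.
This file proves it, with explicit constants, by the Hilbert–Schmidt box around the trivial ring history:

* §1 `ringDeficit_le_of_near_one` — if every slice link and every seam variable is within Frobenius distance `r` of `1`, then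
  `F₀ ≤ 78·L⁴·r²` (✓`ringDeficit_eq_sums`: `2L − 1` kinetic bonds `≤ 6L³r²` each, the seam bond `≤ 24L³r²` (the gauge-transformed
  slice is within `3r`), `2L` Wilson actions `≤ 24L³r²` each by ✓`wilsonAction_le_of_near_one` and gauge invariance);
* §2 `ringMeasure_box_eq` — the ring measure of the box is `ballVol(r)^{6L⁴+L³}` (product structure of ✓`ringMeasure`);
* §3 `pow_four_le_ballVol` — `ballVol r ≥ r⁴/64` for `0 ≤ r ≤ √2/2` (✓`le_haarProbability_su2_two_sub_trace_le` with `η = r²/2`);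
* §4 ★ `pow_le_ringMeasure_deficit_le` ∕ `pow_le_ringMeasure_real_deficit_le` — for `0 ≤ t ≤ 39L⁴`:
  `m₀(t) ≥ (t² / (389376·L⁸))^{6L⁴+L³}`; ★ `exp_le_ringMeasure_real_deficit_le` — for `0 < t ≤ 1`:
  `m₀(t) ≥ exp(−150·L⁵·(1 + log t⁻¹))`.

HONEST FRAMING: crude polynomial bookkeeping on `SU(2)^{6L⁴+L³}` (the true small-ball exponent is `9L⁴ − 3/2`, not `12L⁴ + 2L³`);
a helper for ⟨24141⟩, which stays OPEN together with ⟨24497⟩; no rung / crux / summit statement is proved; the Yang–Mills mass gap is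
NOT proved; no summit is proved by a line.  THEOREMS ONLY (0 `def`, 0 `sorry`), standard axioms.  Width seat `ym-line-sfw-p2-w3` g58
(cell ym-idea-1, free hands), `--supports stmt-QuantumFields-24141`.
References: [cite: Luscher1983, §2]; [cite: MontvayMunster1994, (3.145)]; [cite: Chatterjee2026YMHiggs, Lemma 5.5].
-/

set_option autoImplicit false

noncomputable section

open MeasureTheory
open scoped BigOperators ENNReal Matrix
open Literature.MathematicalPhysics.QuantumFieldTheory hiding SU2
open Literature.MathematicalPhysics.QuantumLattice

namespace Summit.QuantumFields.YangMills.Theorems.VirialFluxGap.VolumeFloor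

open Summit.QuantumFields.YangMills.Theorems.FemtoTransferGap
open Summit.QuantumFields.YangMills.Theorems.FemtoTransferGap.TT
open Summit.QuantumFields.YangMills.Theorems.VirialFluxGap.RingDeficit
open Summit.QuantumFields.YangMills.Theorems.ToronValleyVolume.Lojasiewicz

variable {L : ℕ} [NeZero L]

/-! ## §1 Near-identity algebra: the deficit on the Hilbert–Schmidt box -/

omit [NeZero L] in
/-- A gauge-transformed link is within `a + 2c` of `1` when the link is within `a` and the gauge field within `c` of `1`. [folklore] -/
theorem frobNorm_gaugeTransform_sub_one_le {a c : ℝ} {U : GaugeConfig 3 L SU2} {g : Site 3 L → SU2}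
    (hU : ∀ e, frobNorm ((U e : Matrix (Fin 2) (Fin 2) ℂ) - 1) ≤ a)
    (hg : ∀ x, frobNorm ((g x : Matrix (Fin 2) (Fin 2) ℂ) - 1) ≤ c) (e : Edge 3 L) :
    frobNorm (((gaugeTransform g U e : SU2) : Matrix (Fin 2) (Fin 2) ℂ) - 1) ≤ a + 2 * c := by
  show frobNorm (((g e.1 * U e * (g (e.1.shift e.2))⁻¹ : SU2) : Matrix (Fin 2) (Fin 2) ℂ) - 1) ≤ _
  have h1 := frobNorm_mul_sub_one_le (g e.1 * U e) (g (e.1.shift e.2))⁻¹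
  have h2 := frobNorm_mul_sub_one_le (g e.1) (U e)
  rw [frobNorm_inv_sub_one] at h1
  linarith [hU e, hg e.1, hg (e.1.shift e.2)]

/-- The kinetic bond deficit `6L³ − timeCoupling(U,V)` is at most `3L³·(a+b)²/2` when the links of `U` (resp. `V`) are within `a`
(resp. `b`) of `1` (`2 − Re tr W = ‖W − 1‖²_F/2`, `‖U_eV_e⁻¹ − 1‖_F ≤ a + b`). [cite: MontvayMunster1994, §3.2.3 (3.97)] -/
theorem kinetic_le_of_near_one {a b : ℝ} {U V : GaugeConfig 3 L SU2}
    (hU : ∀ e, frobNorm ((U e : Matrix (Fin 2) (Fin 2) ℂ) - 1) ≤ a)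
    (hV : ∀ e, frobNorm ((V e : Matrix (Fin 2) (Fin 2) ℂ) - 1) ≤ b) :
    6 * (L : ℝ) ^ 3 - timeCoupling su2Rep U V ≤ 3 * (L : ℝ) ^ 3 * ((a + b) ^ 2 / 2) := by
  have hterm : ∀ e : Edge 3 L, 2 - ((su2Rep (U e * (V e)⁻¹)).trace).re ≤ (a + b) ^ 2 / 2 := fun e => by
    rw [fundamentalRep_apply, two_sub_re_trace_eq]
    have h1 := frobNorm_mul_sub_one_le (U e) (V e)⁻¹
    rw [frobNorm_inv_sub_one] at h1
    have h0 : 0 ≤ frobNorm (((U e * (V e)⁻¹ : SU2) : Matrix (Fin 2) (Fin 2) ℂ) - 1) := frobNorm_nonneg _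
    have hle : frobNorm (((U e * (V e)⁻¹ : SU2) : Matrix (Fin 2) (Fin 2) ℂ) - 1) ≤ a + b := by
      linarith [hU e, hV e]
    have hsq := mul_le_mul hle hle h0 (by linarith)
    nlinarith
  have hsum : 6 * (L : ℝ) ^ 3 - timeCoupling su2Rep U V =
      ∑ e : Edge 3 L, (2 - ((su2Rep (U e * (V e)⁻¹)).trace).re) := by
    unfold timeCoupling
    rw [Finset.sum_sub_distrib, Finset.sum_const, Finset.card_univ, FemtoTransferGap.card_edge_three L, nsmul_eq_mul]
    push_cast; ring
  rw [hsum]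
  calc ∑ e : Edge 3 L, (2 - ((su2Rep (U e * (V e)⁻¹)).trace).re)
      ≤ ∑ _e : Edge 3 L, (a + b) ^ 2 / 2 := Finset.sum_le_sum fun e _ => hterm e
    _ = 3 * (L : ℝ) ^ 3 * ((a + b) ^ 2 / 2) := by
        rw [Finset.sum_const, Finset.card_univ, FemtoTransferGap.card_edge_three L, nsmul_eq_mul]
        push_cast; ring

/-- The Wilson action is `≤ 24L³r²` on the box (✓`wilsonAction_le_of_near_one`, `|P| = 3L³`). [cite: Luscher1983, §2] -/
theorem wilsonAction_le_of_near_one' {r : ℝ} (U : GaugeConfig 3 L SU2)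
    (hU : ∀ e, frobNorm ((U e : Matrix (Fin 2) (Fin 2) ℂ) - 1) ≤ r) :
    wilsonAction su2Rep U ≤ 24 * (L : ℝ) ^ 3 * r ^ 2 := by
  have h := wilsonAction_le_of_near_one U hU
  rw [FemtoTransferGap.card_plaquette_three L] at h
  push_cast at h
  linarith

/-- ★ **The zero-flux deficit is `≤ 78·L⁴·r²` on the Hilbert–Schmidt box of radius `r`** (every slice link and every seam variable
within Frobenius distance `r` of `1`). [cite: Luscher1983, §2] -/
theorem ringDeficit_le_of_near_one {r : ℝ}
    {P : (Fin (2 * L - 1 + 1) → GaugeConfig 3 L SU2) × (Site 3 L → SU2)}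
    (h1 : ∀ i e, frobNorm ((P.1 i e : Matrix (Fin 2) (Fin 2) ℂ) - 1) ≤ r)
    (h2 : ∀ x, frobNorm ((P.2 x : Matrix (Fin 2) (Fin 2) ℂ) - 1) ≤ r) :
    ringDeficit L (fun _ => false) P ≤ 78 * (L : ℝ) ^ 4 * r ^ 2 := by
  rw [ringDeficit_eq_sums, twist3_false]
  have hL1 : (1 : ℝ) ≤ L := by exact_mod_cast NeZero.one_le
  have hr2 : 0 ≤ r ^ 2 := sq_nonneg r
  have hL3 : 0 ≤ (L : ℝ) ^ 3 * r ^ 2 := by positivity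
  -- kinetic bonds
  have hkin : ∀ i : Fin (2 * L - 1),
      6 * (L : ℝ) ^ 3 - timeCoupling su2Rep (P.1 i.castSucc) (P.1 i.succ) ≤ 6 * (L : ℝ) ^ 3 * r ^ 2 := fun i => by
    have h := kinetic_le_of_near_one (h1 i.castSucc) (h1 i.succ)
    nlinarith [h]
  -- seam bond
  have hseam : 6 * (L : ℝ) ^ 3 - timeCoupling su2Rep (P.1 (Fin.last (2 * L - 1))) (gaugeTransform P.2 (P.1 0)) ≤
      24 * (L : ℝ) ^ 3 * r ^ 2 := by
    have hg : ∀ e, frobNorm (((gaugeTransform P.2 (P.1 0) e : SU2) : Matrix (Fin 2) (Fin 2) ℂ) - 1) ≤ r + 2 * r :=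
      fun e => frobNorm_gaugeTransform_sub_one_le (h1 0) h2 e
    have h := kinetic_le_of_near_one (h1 (Fin.last (2 * L - 1))) hg
    nlinarith [h]
  -- Wilson actions
  have hS : ∀ i, wilsonAction su2Rep (P.1 i) ≤ 24 * (L : ℝ) ^ 3 * r ^ 2 := fun i =>
    wilsonAction_le_of_near_one' (P.1 i) (h1 i)
  have hSg : wilsonAction su2Rep (gaugeTransform P.2 (P.1 0)) ≤ 24 * (L : ℝ) ^ 3 * r ^ 2 := by
    rw [wilsonAction_gaugeTransform]; exact hS 0
  -- the sums
  have hcast : ((2 * L - 1 : ℕ) : ℝ) = 2 * (L : ℝ) - 1 := by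
    have : 1 ≤ L := NeZero.one_le
    rw [Nat.cast_sub (by omega), Nat.cast_mul]; norm_num
  have hA : ∑ i : Fin (2 * L - 1), (6 * (L : ℝ) ^ 3 - timeCoupling su2Rep (P.1 i.castSucc) (P.1 i.succ)) ≤
      (2 * (L : ℝ) - 1) * (6 * (L : ℝ) ^ 3 * r ^ 2) := by
    calc ∑ i : Fin (2 * L - 1), (6 * (L : ℝ) ^ 3 - timeCoupling su2Rep (P.1 i.castSucc) (P.1 i.succ))
        ≤ ∑ _i : Fin (2 * L - 1), 6 * (L : ℝ) ^ 3 * r ^ 2 := Finset.sum_le_sum fun i _ => hkin i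
      _ = (2 * (L : ℝ) - 1) * (6 * (L : ℝ) ^ 3 * r ^ 2) := by
          rw [Finset.sum_const, Finset.card_univ, Fintype.card_fin, nsmul_eq_mul, hcast]
  have hC : ∑ i : Fin (2 * L - 1), (1 / 2 : ℝ) * (wilsonAction su2Rep (P.1 i.castSucc) + wilsonAction su2Rep (P.1 i.succ)) ≤
      (2 * (L : ℝ) - 1) * (24 * (L : ℝ) ^ 3 * r ^ 2) := by
    calc ∑ i : Fin (2 * L - 1), (1 / 2 : ℝ) * (wilsonAction su2Rep (P.1 i.castSucc) + wilsonAction su2Rep (P.1 i.succ))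
        ≤ ∑ _i : Fin (2 * L - 1), 24 * (L : ℝ) ^ 3 * r ^ 2 :=
          Finset.sum_le_sum fun i _ => by linarith [hS i.castSucc, hS i.succ]
      _ = (2 * (L : ℝ) - 1) * (24 * (L : ℝ) ^ 3 * r ^ 2) := by
          rw [Finset.sum_const, Finset.card_univ, Fintype.card_fin, nsmul_eq_mul, hcast]
  have hD : (1 / 2 : ℝ) * (wilsonAction su2Rep (P.1 (Fin.last (2 * L - 1))) + wilsonAction su2Rep (gaugeTransform P.2 (P.1 0))) ≤
      24 * (L : ℝ) ^ 3 * r ^ 2 := by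
    linarith [hS (Fin.last (2 * L - 1)), hSg]
  have hmono : (L : ℝ) ^ 3 * r ^ 2 ≤ (L : ℝ) ^ 4 * r ^ 2 := by
    have h := mul_nonneg (mul_nonneg (pow_nonneg (Nat.cast_nonneg L) 3) (sub_nonneg.2 hL1)) hr2
    nlinarith [h]
  nlinarith [hA, hseam, hC, hD, hmono]

/-- The Hilbert–Schmidt box of radius `r` lies in the sublevel set `{F₀ ≤ 78·L⁴·r²}`. [cite: Luscher1983, §2] -/
theorem box_subset_deficit_le (r : ℝ) :
    {P : (Fin (2 * L - 1 + 1) → GaugeConfig 3 L SU2) × (Site 3 L → SU2) |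
        (∀ i e, frobNorm ((P.1 i e : Matrix (Fin 2) (Fin 2) ℂ) - 1) ≤ r) ∧
          ∀ x, frobNorm ((P.2 x : Matrix (Fin 2) (Fin 2) ℂ) - 1) ≤ r} ⊆
      {P | ringDeficit L (fun _ => false) P ≤ 78 * (L : ℝ) ^ 4 * r ^ 2} :=
  fun _ hP => ringDeficit_le_of_near_one hP.1 hP.2

/-! ## §2 The box and its ring measure -/

omit [NeZero L] in
/-- The ring box is the product of the slice boxes and the seam box. [folklore] -/
theorem box_eq_prod (r : ℝ) :
    {P : (Fin (2 * L - 1 + 1) → GaugeConfig 3 L SU2) × (Site 3 L → SU2) |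
        (∀ i e, frobNorm ((P.1 i e : Matrix (Fin 2) (Fin 2) ℂ) - 1) ≤ r) ∧
          ∀ x, frobNorm ((P.2 x : Matrix (Fin 2) (Fin 2) ℂ) - 1) ≤ r} =
      (Set.pi Set.univ fun _ : Fin (2 * L - 1 + 1) =>
          {U : GaugeConfig 3 L SU2 | ∀ e, frobNorm ((U e : Matrix (Fin 2) (Fin 2) ℂ) - 1) ≤ r}) ×ˢ
        (Set.pi Set.univ fun _ : Site 3 L => {W : SU2 | frobNorm ((W : Matrix (Fin 2) (Fin 2) ℂ) - 1) ≤ r}) := by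
  ext P
  simp only [Set.mem_setOf_eq, Set.mem_prod, Set.mem_univ_pi]

/-- The one-variable Hilbert–Schmidt ball has Haar measure `ballVol r` (as an extended real). [folklore] -/
theorem haar_frobBall_eq (r : ℝ) :
    haarProbability SU2 {W : SU2 | frobNorm ((W : Matrix (Fin 2) (Fin 2) ℂ) - 1) ≤ r} = ENNReal.ofReal (ballVol r) := by
  rw [ballVol, measureReal_def, ENNReal.ofReal_toReal (measure_ne_top _ _)]

/-- The slice box has `configMeasure` `ballVol(r)^{|E|}` (as an extended real). [folklore] -/
theorem configMeasure_box_eq (r : ℝ) :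
    configMeasure SU2 L {U : GaugeConfig 3 L SU2 | ∀ e, frobNorm ((U e : Matrix (Fin 2) (Fin 2) ℂ) - 1) ≤ r} =
      ENNReal.ofReal (ballVol r) ^ Fintype.card (Edge 3 L) := by
  rw [box_eq_pi, configMeasure, Measure.pi_pi, Finset.prod_const, Finset.card_univ, haar_frobBall_eq]

/-- The seam box has `gaugeMeasure` `ballVol(r)^{|sites|}` (as an extended real). [folklore] -/
theorem gaugeMeasure_box_eq (r : ℝ) :
    gaugeMeasure L (Set.pi Set.univ fun _ : Site 3 L => {W : SU2 | frobNorm ((W : Matrix (Fin 2) (Fin 2) ℂ) - 1) ≤ r}) =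
      ENNReal.ofReal (ballVol r) ^ Fintype.card (Site 3 L) := by
  rw [gaugeMeasure, Measure.pi_pi, Finset.prod_const, Finset.card_univ, haar_frobBall_eq]

/-- The number of `SU(2)` variables of a ring history: `2L · 3L³ + L³ = 6L⁴ + L³`. [folklore] -/
theorem card_ring_variables :
    (2 * L - 1 + 1) * Fintype.card (Edge 3 L) + Fintype.card (Site 3 L) = 6 * L ^ 4 + L ^ 3 := by
  have hL : 1 ≤ L := NeZero.one_le
  rw [FemtoTransferGap.card_edge_three L, TwoLattice.Electric.card_site, show 2 * L - 1 + 1 = 2 * L by omega]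
  ring

/-- ★ **The ring measure of the Hilbert–Schmidt box is `ballVol(r)^{6L⁴+L³}`.** [folklore] -/
theorem ringMeasure_box_eq (r : ℝ) :
    ringMeasure L {P : (Fin (2 * L - 1 + 1) → GaugeConfig 3 L SU2) × (Site 3 L → SU2) |
        (∀ i e, frobNorm ((P.1 i e : Matrix (Fin 2) (Fin 2) ℂ) - 1) ≤ r) ∧
          ∀ x, frobNorm ((P.2 x : Matrix (Fin 2) (Fin 2) ℂ) - 1) ≤ r} =
      ENNReal.ofReal (ballVol r) ^ (6 * L ^ 4 + L ^ 3) := by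
  haveI := isProbabilityMeasure_gaugeMeasure (L := L)
  rw [box_eq_prod, ringMeasure, Measure.prod_prod, Measure.pi_pi]
  simp only [configMeasure_box_eq, Finset.prod_const, Finset.card_univ, Fintype.card_fin, gaugeMeasure_box_eq]
  rw [← pow_mul, ← pow_add, ← card_ring_variables (L := L), mul_comm]

/-! ## §3 The Haar volume of a small Hilbert–Schmidt ball is at least `r⁴/64` -/

/-- ★ `r⁴/64 ≤ ballVol r` for `0 ≤ r ≤ √2/2`: the trace-neighbourhood `{2 − Re tr ≤ r²/2}` of ✓`le_haarProbability_su2_two_sub_trace_le`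
(Haar mass `≥ (r²/2)²/16`) is contained in the Hilbert–Schmidt ball (`2 − Re tr W = ‖W − 1‖²_F/2`). [cite: Chatterjee2026YMHiggs, Lemma 5.5] -/
theorem pow_four_le_ballVol {r : ℝ} (hr0 : 0 ≤ r) (hr : r ≤ Real.sqrt 2 / 2) : r ^ 4 / 64 ≤ ballVol r := by
  rcases eq_or_lt_of_le hr0 with h | hrpos
  · rw [← h]; norm_num; exact ballVol_nonneg _
  have hη0 : 0 < r ^ 2 / 2 := by positivity
  have hη : r ^ 2 / 2 ≤ 1 / 4 := by
    have h2 : r ^ 2 ≤ (Real.sqrt 2 / 2) ^ 2 := pow_le_pow_left₀ hr0 hr 2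
    rw [div_pow, Real.sq_sqrt (by norm_num : (0 : ℝ) ≤ 2)] at h2
    linarith
  have h := le_haarProbability_su2_two_sub_trace_le hη0 hη
  have hsub : {U : SU2 | 2 - ((U : Matrix (Fin 2) (Fin 2) ℂ).trace).re ≤ r ^ 2 / 2} ⊆
      {W : SU2 | frobNorm ((W : Matrix (Fin 2) (Fin 2) ℂ) - 1) ≤ r} := by
    intro U hU
    simp only [Set.mem_setOf_eq] at hU ⊢
    rw [two_sub_re_trace_eq] at hU
    have h0 := frobNorm_nonneg ((U : Matrix (Fin 2) (Fin 2) ℂ) - 1)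
    have h2 : frobNorm ((U : Matrix (Fin 2) (Fin 2) ℂ) - 1) ^ 2 ≤ r ^ 2 := by linarith
    exact (sq_le_sq₀ h0 hr0).1 h2
  have hmono : (haarProbability SU2) {U : SU2 | 2 - ((U : Matrix (Fin 2) (Fin 2) ℂ).trace).re ≤ r ^ 2 / 2} ≤
      (haarProbability SU2) {W : SU2 | frobNorm ((W : Matrix (Fin 2) (Fin 2) ℂ) - 1) ≤ r} := measure_mono hsub
  have h3 : ENNReal.ofReal ((r ^ 2 / 2) ^ 2 / 16) ≤ ENNReal.ofReal (ballVol r) := by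
    rw [← haar_frobBall_eq]; exact h.trans hmono
  have h4 := (ENNReal.ofReal_le_ofReal_iff (ballVol_nonneg r)).1 h3
  have h5 : (r ^ 2 / 2) ^ 2 / 16 = r ^ 4 / 64 := by ring
  linarith

/-! ## §4 The floor -/

/-- ★★ **Periodic volume floor, power form**: for `0 ≤ t ≤ 39·L⁴`,
`(t²/(389376·L⁸))^{6L⁴+L³} ≤ ringMeasure L {F₀ ≤ t}` (box of radius `r = √(t/(78L⁴)) ≤ √2/2`, `ballVol r ≥ r⁴/64 = t²/(389376 L⁸)`).
[cite: Luscher1983, §2] -/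
theorem pow_le_ringMeasure_deficit_le {t : ℝ} (ht0 : 0 ≤ t) (ht : t ≤ 39 * (L : ℝ) ^ 4) :
    ENNReal.ofReal ((t ^ 2 / (389376 * (L : ℝ) ^ 8)) ^ (6 * L ^ 4 + L ^ 3)) ≤
      ringMeasure L {P | ringDeficit L (fun _ => false) P ≤ t} := by
  have hL : (0 : ℝ) < L := by exact_mod_cast NeZero.pos L
  have hL4 : (0 : ℝ) < 78 * (L : ℝ) ^ 4 := by positivity
  set r : ℝ := Real.sqrt (t / (78 * (L : ℝ) ^ 4)) with hr
  have hr0 : 0 ≤ r := Real.sqrt_nonneg _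
  have hr2 : r ^ 2 = t / (78 * (L : ℝ) ^ 4) := Real.sq_sqrt (by positivity)
  have h78 : 78 * (L : ℝ) ^ 4 * r ^ 2 = t := by rw [hr2]; field_simp
  have hrle : r ≤ Real.sqrt 2 / 2 := by
    have h2 : r ^ 2 ≤ (Real.sqrt 2 / 2) ^ 2 := by
      rw [hr2, div_pow, Real.sq_sqrt (by norm_num : (0 : ℝ) ≤ 2), div_le_iff₀ hL4]
      linarith
    exact (sq_le_sq₀ hr0 (by positivity)).1 h2
  have hr4 : (t ^ 2 / (389376 * (L : ℝ) ^ 8)) = r ^ 4 / 64 := by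
    rw [show r ^ 4 = (r ^ 2) ^ 2 by ring, hr2]
    field_simp
    ring
  calc ENNReal.ofReal ((t ^ 2 / (389376 * (L : ℝ) ^ 8)) ^ (6 * L ^ 4 + L ^ 3))
      = ENNReal.ofReal (r ^ 4 / 64) ^ (6 * L ^ 4 + L ^ 3) := by
        rw [ENNReal.ofReal_pow (by positivity), hr4]
    _ ≤ ENNReal.ofReal (ballVol r) ^ (6 * L ^ 4 + L ^ 3) := by
        gcongr
        exact pow_four_le_ballVol hr0 hrle
    _ = ringMeasure L {P : (Fin (2 * L - 1 + 1) → GaugeConfig 3 L SU2) × (Site 3 L → SU2) |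
          (∀ i e, frobNorm ((P.1 i e : Matrix (Fin 2) (Fin 2) ℂ) - 1) ≤ r) ∧
            ∀ x, frobNorm ((P.2 x : Matrix (Fin 2) (Fin 2) ℂ) - 1) ≤ r} := (ringMeasure_box_eq r).symm
    _ ≤ ringMeasure L {P | ringDeficit L (fun _ => false) P ≤ 78 * (L : ℝ) ^ 4 * r ^ 2} :=
        measure_mono (box_subset_deficit_le r)
    _ = ringMeasure L {P | ringDeficit L (fun _ => false) P ≤ t} := by rw [h78]

/-- ★★ **Periodic volume floor, power form (real-valued)**: for `0 ≤ t ≤ 39·L⁴`,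
`(t²/(389376·L⁸))^{6L⁴+L³} ≤ (ringMeasure L).real {F₀ ≤ t}`. [cite: Luscher1983, §2] -/
theorem pow_le_ringMeasure_real_deficit_le {t : ℝ} (ht0 : 0 ≤ t) (ht : t ≤ 39 * (L : ℝ) ^ 4) :
    (t ^ 2 / (389376 * (L : ℝ) ^ 8)) ^ (6 * L ^ 4 + L ^ 3) ≤
      (ringMeasure L).real {P | ringDeficit L (fun _ => false) P ≤ t} := by
  haveI := isProbabilityMeasure_ringMeasure (L := L)
  rw [measureReal_def]
  exact (ENNReal.ofReal_le_iff_le_toReal (measure_ne_top _ _)).1 (pow_le_ringMeasure_deficit_le ht0 ht)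

/-- `log 389376 ≤ 13` (`389376 = 64·78² ≤ e^{13}`). [folklore] -/
theorem log_389376_le : Real.log 389376 ≤ 13 := by
  rw [Real.log_le_iff_le_exp (by norm_num)]
  have h1 := Real.exp_one_gt_d9
  have h2 : Real.exp 13 = Real.exp 1 ^ 13 := by rw [← Real.exp_nat_mul]; norm_num
  rw [h2]
  have h3 : (2.7182818283 : ℝ) ^ 13 ≤ Real.exp 1 ^ 13 := pow_le_pow_left₀ (by norm_num) h1.le 13
  have h4 : (389376 : ℝ) ≤ (2.7182818283 : ℝ) ^ 13 := by norm_num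
  linarith

/-- ★★★ **Periodic volume floor, exponential form**: for every `L ≥ 1` and `0 < t ≤ 1`,
`exp(−150·L⁵·(1 + log t⁻¹)) ≤ (ringMeasure L).real {F₀ ≤ t}` — the floor `m₁` of the one-sided Tauberian reduction
✓`ScalingTauber.scalingTauber` and the large-field tail control of the virial route, at any polynomial scale `t = 1/poly(L)` with a
polynomial exponent. [cite: Luscher1983, §2] -/
theorem exp_le_ringMeasure_real_deficit_le {t : ℝ} (ht0 : 0 < t) (ht1 : t ≤ 1) :
    Real.exp (-(150 * (L : ℝ) ^ 5 * (1 + Real.log t⁻¹))) ≤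
      (ringMeasure L).real {P | ringDeficit L (fun _ => false) P ≤ t} := by
  have hL1 : (1 : ℝ) ≤ L := by exact_mod_cast NeZero.one_le
  have hL : (0 : ℝ) < L := by linarith
  have ht39 : t ≤ 39 * (L : ℝ) ^ 4 := by nlinarith [one_le_pow₀ (n := 4) hL1]
  refine le_trans ?_ (pow_le_ringMeasure_real_deficit_le ht0.le ht39)
  -- take logarithms
  have hbase : 0 < t ^ 2 / (389376 * (L : ℝ) ^ 8) := by positivity
  rw [← Real.exp_log (pow_pos hbase _), Real.exp_le_exp, Real.log_pow, Real.log_div (by positivity) (by positivity),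
    Real.log_mul (by norm_num) (by positivity), Real.log_pow, Real.log_pow, Real.log_inv]
  -- `log t ≤ 0`, `0 ≤ log L ≤ L`, `log 389376 ≤ 13`
  have hlt : Real.log t ≤ 0 := Real.log_nonpos ht0.le ht1
  have hlL0 : 0 ≤ Real.log L := Real.log_nonneg hL1
  have hlL : Real.log L ≤ (L : ℝ) := (Real.log_le_sub_one_of_pos hL).trans (by linarith)
  have h389 := log_389376_le
  have hN : ((6 * L ^ 4 + L ^ 3 : ℕ) : ℝ) = 6 * (L : ℝ) ^ 4 + (L : ℝ) ^ 3 := by push_cast; ring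
  rw [hN]
  push_cast
  have hL3 : (L : ℝ) ^ 3 ≤ (L : ℝ) ^ 4 := by
    rw [show (L : ℝ) ^ 4 = (L : ℝ) ^ 3 * L by ring]
    exact le_mul_of_one_le_right (by positivity) hL1
  have hL45 : (L : ℝ) ^ 4 ≤ (L : ℝ) ^ 5 := by
    rw [show (L : ℝ) ^ 5 = (L : ℝ) ^ 4 * L by ring]
    exact le_mul_of_one_le_right (by positivity) hL1
  have hnlt : 0 ≤ -Real.log t := by linarith
  have h1 : (L : ℝ) ^ 3 * (-Real.log t) ≤ (L : ℝ) ^ 4 * (-Real.log t) := mul_le_mul_of_nonneg_right hL3 hnlt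
  have h2 : (L : ℝ) ^ 4 * (-Real.log t) ≤ (L : ℝ) ^ 5 * (-Real.log t) := mul_le_mul_of_nonneg_right hL45 hnlt
  have h3 : (L : ℝ) ^ 3 * Real.log L ≤ (L : ℝ) ^ 4 * Real.log L := mul_le_mul_of_nonneg_right hL3 hlL0
  have h4 : (L : ℝ) ^ 4 * Real.log L ≤ (L : ℝ) ^ 5 := by
    rw [show (L : ℝ) ^ 5 = (L : ℝ) ^ 4 * L by ring]
    exact mul_le_mul_of_nonneg_left hlL (by positivity)
  have h5 : (6 * (L : ℝ) ^ 4 + (L : ℝ) ^ 3) * Real.log 389376 ≤ (6 * (L : ℝ) ^ 4 + (L : ℝ) ^ 3) * 13 :=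
    mul_le_mul_of_nonneg_left h389 (by positivity)
  have h6 : 0 ≤ (L : ℝ) ^ 5 := by positivity
  have h7 : 0 ≤ (L : ℝ) ^ 3 * Real.log L := mul_nonneg (by positivity) hlL0
  have h8 : 0 ≤ (L : ℝ) ^ 3 * (-Real.log t) := mul_nonneg (by positivity) hnlt
  linarith

end Summit.QuantumFields.YangMills.Theorems.VirialFluxGap.VolumeFloor

end
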